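import Summits.BirchSwinnertonDyer.BirchSwinnertonDyer.Theorems.ByReductionTypeAtTwoRankOneAtTwoBigImageOddLocalOneDoorFirstDescentAtTwo
import HarnessLib

/-!
# Route ByReductionTypeAtTwo, crux `RankOneAtTwoBigImageOddLocal` (stmt-BirchSwinnertonDyer-23715):
# Kolyvagin's first `2`-descent over `ℚ` at a minimal door — the TWIN SIDE IN ITS OWN SPACE (two-space form of the engine)

Lead prover seat `bsd-line-fkl-p1` g12 (2026-08-28), `--supports stmt-BirchSwinnertonDyer-23715` (helper).  Pure algebra over
explicit hypotheses (theorems only, no definitions), companion of `Theorems/…OneDoorFirstDescentAtTwo.lean` (p637958).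

Why a second form.  The engine p637958 puts `Sel₂(E/ℚ)` and `Sel₂(E^K/ℚ)` in ONE group `V = H¹(ℚ, E[2])` and transfers
relaxedness between the two through `hloc'` (Mazur–Rubin 2010 Lemma 2.10: the local conditions of `E` and `E^K` agree off the
error place `q₀`).  The tree has no identification `H¹(ℚ, E^{(d)}[2]) ≅ H¹(ℚ, E[2])` over `ℚ` (only `hPsiKT` over `K`), whereas
route GenusKolyvaginAtTwo's visible-pair instantiation (`Theorems/GenusKolyvaginAtTwoVisiblePairAtTwoDefs.lean`) works with TWO
groups `V₁ = H¹(ℚ, E[2^M])`, `V₂ = H¹(ℚ, E^{(d_K)}[2^M])`, Kolyvagin's odd-depth classes living in `V₂`, and a CROSS condition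
(McCallum Prop. 4.4: `c₂(ℓ) ∈ Loc₂(λ) ↔ x ∈ A₁(ℓ)`).  This file runs the twin half of the first descent in that format: the
Selmer group `Sel₂ ⊆ V₂` of the twin is shown to vanish from first-layer classes `c₂(ℓ) ∈ V₂` (Gross 6.2 (1) in the TWIN's local
conditions off `{ℓ, q₀}` — `hc`; 6.2 (2) ACROSS — `hcℓ : c₂ ℓ ∈ Loc₂ (pl ℓ) ↔ y ∈ A₁ ℓ` with `y = δ(T·y_K) ∈ V₁`), reciprocity
inside `V₂` (`hrec`), a CROSS Čebotarev hypothesis (`hceb : s ∈ V₂` relaxed and non-zero ⟹ some Kolyvagin `ℓ` with `s ∉ A₂ ℓ`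
and `y ∉ A₁ ℓ`), the one-line condition at `q₀` (`hline₂`) and parity (`heven`).  NO `hloc'` is needed: each side uses its own
classes in its own local conditions.  The E-side of p637958 is unchanged (it never mentions the twin).

Also proved: the two DISCHARGE lemmas turning a VISIBLE Čebotarev statement (Kolyvagin primes prescribed for classes that are
independent after restriction maps `rK₁ : V₁ → H`, `rK₂ : V₂ → H`, as in `KolyvaginDescent.VisiblePairHypothesesM.cebotarev`) into
the engine's `hceb` hypotheses: on the E-side the excluded class is `y` itself (handled by `hceb₁` inside p637958); on the twin
side the one class `s` with `rK₂ s = rK₁ y` («the twin copy of `y`») is served by ANY Kolyvagin prime singular for `y`, because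
the strict condition at `ℓ` is read after restriction (`hA₁`, `hA₂`).

Dictionary at instantiation (U₀, both signs): `V₁ = galH1Torsion W 2`, `V₂ = galH1Torsion Wd 2`, `Loc₂ v = selmerLocalKer Wd ℚ_v 2`,
`A₁ ℓ / A₂ ℓ = torsionLocalKer` at `v_ℓ`, `A₂₀ = torsionLocalKer Wd` at `q₀`, `Sel₂ = selmerGroup Wd 2`, `Kol` = Kolyvagin primes at
`M = 2` with Frobenius a transposition on `E[2]` (Gross primes at `Δ_E < 0`, regular primes at `Δ_E > 0`), `q₀` = the one error place
of a minimal door (`v_{q₀}` resp. `∞`).  Nothing about elliptic curves is asserted here; BSD is not proved by any of this.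

References: [GrossLMS1991] §§6, 8–10; [McCallumLMS1991] p. 299, Cor. 3.2, Prop. 4.4, Lemma 5.3; [MazurRubin2010] Lemmas 2.2, 2.10;
[Kolyvagin1989Izv] §3 (the pair `(E, E^D)` over `ℚ`).
-/

set_option autoImplicit false
-- the Theorems namespace of this sub repeats the summit name by design (D-0017 nested layout)
set_option linter.dupNamespace false

namespace Summit.BirchSwinnertonDyer.BirchSwinnertonDyer.Theorems.RankOneAtTwoOneDoor

section FirstDescentPairAtTwo

variable {V₁ V₂ : Type*} [AddCommGroup V₁] [AddCommGroup V₂] {Pl : Type*}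

/-- **Twin side, two-space form: the localisation at the error place `q₀` is injective on RELAXED classes of `V₂`**
(classes in the twin's local condition `Loc₂ v` at every `v ≠ q₀`).  Data: `Loc₂`, `q₀`, `A₂₀ = ker res_{q₀}` on `V₂`, `Kol`,
`pl`, strict conditions `A₁ ℓ ≤ V₁`, `A₂ ℓ ≤ V₂`, `y ∈ V₁`, first-layer classes `c₂ ℓ ∈ V₂`.  Hypotheses: `hc` = Gross 6.2 (1) for
the twin-descended class off `{ℓ, q₀}`; `hcℓ` = 6.2 (2) ACROSS (McCallum Prop. 4.4 from depth `1` to depth `ℓ`); `hrec` =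
Poitou–Tate in `V₂` + perfect pairing of the lines at `ℓ`; `hceb` = Čebotarev at `M = 2` for the pair `(y, s)`.  Proof: pick `ℓ`
with `s ∉ A₂ ℓ`, `y ∉ A₁ ℓ`; then `c₂ ℓ` is singular at `ℓ` and reciprocity for `(s, c₂ ℓ)` forbids `s ∈ A₂₀`.
[cite: GrossLMS1991, §10 (Claim 10.1)] [cite: McCallumLMS1991, Prop. 4.4 and Lemma 5.3] -/
theorem res_errorPlace_ne_zero_of_relaxed₂ (Loc₂ : Pl → AddSubgroup V₂) (q₀ : Pl) (A₂₀ : AddSubgroup V₂) (Kol : ℕ → Prop)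
    (pl : ℕ → Pl) (A₁ : ℕ → AddSubgroup V₁) (A₂ : ℕ → AddSubgroup V₂) (y : V₁) (c₂ : ℕ → V₂)
    (hc : ∀ ℓ, Kol ℓ → ∀ v, v ≠ pl ℓ → v ≠ q₀ → c₂ ℓ ∈ Loc₂ v)
    (hcℓ : ∀ ℓ, Kol ℓ → (c₂ ℓ ∈ Loc₂ (pl ℓ) ↔ y ∈ A₁ ℓ))
    (hrec : ∀ ℓ, Kol ℓ → ∀ d : V₂, (∀ v, v ≠ pl ℓ → v ≠ q₀ → d ∈ Loc₂ v) → d ∉ Loc₂ (pl ℓ) →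
      ∀ s : V₂, (∀ v, v ≠ q₀ → s ∈ Loc₂ v) → s ∉ A₂ ℓ → s ∉ A₂₀)
    (hceb : ∀ s : V₂, s ≠ 0 → (∀ v, v ≠ q₀ → s ∈ Loc₂ v) → ∃ ℓ, Kol ℓ ∧ s ∉ A₂ ℓ ∧ y ∉ A₁ ℓ)
    {s : V₂} (hs : ∀ v, v ≠ q₀ → s ∈ Loc₂ v) (h0 : s ≠ 0) : s ∉ A₂₀ := by
  obtain ⟨ℓ, hℓ, hsA, hyA⟩ := hceb s h0 hs
  have hsing : c₂ ℓ ∉ Loc₂ (pl ℓ) := fun h => hyA ((hcℓ ℓ hℓ).mp h)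
  exact hrec ℓ hℓ (c₂ ℓ) (hc ℓ hℓ) hsing s hs hsA

/-- **Two relaxed classes of `V₂` with the same localisation at `q₀` are equal** (injectivity applied to the difference).
[cite: MazurRubin2010, Def. 3.1 and Prop. 3.3] [cite: GrossLMS1991, §10] -/
theorem eq_of_relaxed_of_sub_mem_errorKer₂ (Loc₂ : Pl → AddSubgroup V₂) (q₀ : Pl) (A₂₀ : AddSubgroup V₂) (Kol : ℕ → Prop)
    (pl : ℕ → Pl) (A₁ : ℕ → AddSubgroup V₁) (A₂ : ℕ → AddSubgroup V₂) (y : V₁) (c₂ : ℕ → V₂)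
    (hc : ∀ ℓ, Kol ℓ → ∀ v, v ≠ pl ℓ → v ≠ q₀ → c₂ ℓ ∈ Loc₂ v)
    (hcℓ : ∀ ℓ, Kol ℓ → (c₂ ℓ ∈ Loc₂ (pl ℓ) ↔ y ∈ A₁ ℓ))
    (hrec : ∀ ℓ, Kol ℓ → ∀ d : V₂, (∀ v, v ≠ pl ℓ → v ≠ q₀ → d ∈ Loc₂ v) → d ∉ Loc₂ (pl ℓ) →
      ∀ s : V₂, (∀ v, v ≠ q₀ → s ∈ Loc₂ v) → s ∉ A₂ ℓ → s ∉ A₂₀)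
    (hceb : ∀ s : V₂, s ≠ 0 → (∀ v, v ≠ q₀ → s ∈ Loc₂ v) → ∃ ℓ, Kol ℓ ∧ s ∉ A₂ ℓ ∧ y ∉ A₁ ℓ)
    {s t : V₂} (hs : ∀ v, v ≠ q₀ → s ∈ Loc₂ v) (ht : ∀ v, v ≠ q₀ → t ∈ Loc₂ v) (hst : s - t ∈ A₂₀) : s = t := by
  by_contra hne
  exact res_errorPlace_ne_zero_of_relaxed₂ Loc₂ q₀ A₂₀ Kol pl A₁ A₂ y c₂ hc hcℓ hrec hceb
    (fun v hv => (Loc₂ v).sub_mem (hs v hv) (ht v hv)) (sub_ne_zero.mpr hne) hst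

/-- **Twin side, two-space form: `Sel₂(E^K/ℚ) = 0`, elementwise.**  Extra data: `Sel₂ ≤ V₂` cut out by `Loc₂` (`hsel₂`);
`hline₂` = Mazur–Rubin 2010 Lemma 2.2 (i) at `q₀` for the twin (the Kummer image at the error place is ONE line: two classes
of `Loc₂ q₀` with non-zero localisation differ by an element of `ker res_{q₀}`); `heven` = Cassels–Tate parity (a non-zero
Selmer class is never alone).  A non-zero `s ∈ Sel₂` comes with `t ∈ Sel₂ ∖ {0, s}`; both have non-zero localisation at `q₀`
(injectivity), so `t − s ∈ ker res_{q₀}` is relaxed and non-zero — contradiction.  [cite: GrossLMS1991, §10]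
[cite: MazurRubin2010, Lemma 2.2 (i)] [cite: Kolyvagin1989Izv, §3] -/
theorem eq_zero_of_mem_twinSel₂ (Loc₂ : Pl → AddSubgroup V₂) (q₀ : Pl) (A₂₀ : AddSubgroup V₂) (Kol : ℕ → Prop)
    (pl : ℕ → Pl) (A₁ : ℕ → AddSubgroup V₁) (A₂ : ℕ → AddSubgroup V₂) (y : V₁) (c₂ : ℕ → V₂)
    (hc : ∀ ℓ, Kol ℓ → ∀ v, v ≠ pl ℓ → v ≠ q₀ → c₂ ℓ ∈ Loc₂ v)
    (hcℓ : ∀ ℓ, Kol ℓ → (c₂ ℓ ∈ Loc₂ (pl ℓ) ↔ y ∈ A₁ ℓ))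
    (hrec : ∀ ℓ, Kol ℓ → ∀ d : V₂, (∀ v, v ≠ pl ℓ → v ≠ q₀ → d ∈ Loc₂ v) → d ∉ Loc₂ (pl ℓ) →
      ∀ s : V₂, (∀ v, v ≠ q₀ → s ∈ Loc₂ v) → s ∉ A₂ ℓ → s ∉ A₂₀)
    (hceb : ∀ s : V₂, s ≠ 0 → (∀ v, v ≠ q₀ → s ∈ Loc₂ v) → ∃ ℓ, Kol ℓ ∧ s ∉ A₂ ℓ ∧ y ∉ A₁ ℓ)
    (hline₂ : ∀ s t : V₂, s ∈ Loc₂ q₀ → t ∈ Loc₂ q₀ → s ∉ A₂₀ → t ∉ A₂₀ → s - t ∈ A₂₀)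
    (Sel₂ : AddSubgroup V₂) (hsel₂ : ∀ s, s ∈ Sel₂ ↔ ∀ v, s ∈ Loc₂ v)
    (heven : ∀ s ∈ Sel₂, s ≠ 0 → ∃ t ∈ Sel₂, t ≠ 0 ∧ t ≠ s)
    {s : V₂} (hs : s ∈ Sel₂) : s = 0 := by
  have hrel : ∀ {u : V₂}, u ∈ Sel₂ → ∀ v, v ≠ q₀ → u ∈ Loc₂ v := fun hu v _ => (hsel₂ _).mp hu v
  by_contra h0
  obtain ⟨t, ht, ht0, hts⟩ := heven s hs h0
  have hsA : s ∉ A₂₀ := res_errorPlace_ne_zero_of_relaxed₂ Loc₂ q₀ A₂₀ Kol pl A₁ A₂ y c₂ hc hcℓ hrec hceb (hrel hs) h0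
  have htA : t ∉ A₂₀ := res_errorPlace_ne_zero_of_relaxed₂ Loc₂ q₀ A₂₀ Kol pl A₁ A₂ y c₂ hc hcℓ hrec hceb (hrel ht) ht0
  exact hts (eq_of_relaxed_of_sub_mem_errorKer₂ Loc₂ q₀ A₂₀ Kol pl A₁ A₂ y c₂ hc hcℓ hrec hceb (hrel ht) (hrel hs)
    (hline₂ t s ((hsel₂ t).mp ht q₀) ((hsel₂ s).mp hs q₀) htA hsA))

/-- **Twin side, two-space form: `Sel₂ = ⊥`** (so `Ш(E^K/ℚ)[2] = 0` and `#Sel₂(E^K/ℚ) = 1` at instantiation).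
[cite: GrossLMS1991, §10] [cite: Kolyvagin1989Izv, §3 (Thm. B_l, l = 2)] -/
theorem twinSel_eq_bot₂ (Loc₂ : Pl → AddSubgroup V₂) (q₀ : Pl) (A₂₀ : AddSubgroup V₂) (Kol : ℕ → Prop)
    (pl : ℕ → Pl) (A₁ : ℕ → AddSubgroup V₁) (A₂ : ℕ → AddSubgroup V₂) (y : V₁) (c₂ : ℕ → V₂)
    (hc : ∀ ℓ, Kol ℓ → ∀ v, v ≠ pl ℓ → v ≠ q₀ → c₂ ℓ ∈ Loc₂ v)
    (hcℓ : ∀ ℓ, Kol ℓ → (c₂ ℓ ∈ Loc₂ (pl ℓ) ↔ y ∈ A₁ ℓ))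
    (hrec : ∀ ℓ, Kol ℓ → ∀ d : V₂, (∀ v, v ≠ pl ℓ → v ≠ q₀ → d ∈ Loc₂ v) → d ∉ Loc₂ (pl ℓ) →
      ∀ s : V₂, (∀ v, v ≠ q₀ → s ∈ Loc₂ v) → s ∉ A₂ ℓ → s ∉ A₂₀)
    (hceb : ∀ s : V₂, s ≠ 0 → (∀ v, v ≠ q₀ → s ∈ Loc₂ v) → ∃ ℓ, Kol ℓ ∧ s ∉ A₂ ℓ ∧ y ∉ A₁ ℓ)
    (hline₂ : ∀ s t : V₂, s ∈ Loc₂ q₀ → t ∈ Loc₂ q₀ → s ∉ A₂₀ → t ∉ A₂₀ → s - t ∈ A₂₀)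
    (Sel₂ : AddSubgroup V₂) (hsel₂ : ∀ s, s ∈ Sel₂ ↔ ∀ v, s ∈ Loc₂ v)
    (heven : ∀ s ∈ Sel₂, s ≠ 0 → ∃ t ∈ Sel₂, t ≠ 0 ∧ t ≠ s) :
    Sel₂ = ⊥ :=
  (AddSubgroup.eq_bot_iff_forall _).mpr fun _ hs =>
    eq_zero_of_mem_twinSel₂ Loc₂ q₀ A₂₀ Kol pl A₁ A₂ y c₂ hc hcℓ hrec hceb hline₂ Sel₂ hsel₂ heven hs

/-- **`#Sel₂ = 1`** under the hypotheses of `twinSel_eq_bot₂` — the count consumed by the Selmer-to-door glue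
`doorIndexLawUpperCAtTwoBottom_of_selmerTwo` (`Theorems/…OneDoorBottomSelmerGlue.lean`). [cite: GrossLMS1991, §10] -/
theorem card_twinSel_eq_one₂ (Loc₂ : Pl → AddSubgroup V₂) (q₀ : Pl) (A₂₀ : AddSubgroup V₂) (Kol : ℕ → Prop)
    (pl : ℕ → Pl) (A₁ : ℕ → AddSubgroup V₁) (A₂ : ℕ → AddSubgroup V₂) (y : V₁) (c₂ : ℕ → V₂)
    (hc : ∀ ℓ, Kol ℓ → ∀ v, v ≠ pl ℓ → v ≠ q₀ → c₂ ℓ ∈ Loc₂ v)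
    (hcℓ : ∀ ℓ, Kol ℓ → (c₂ ℓ ∈ Loc₂ (pl ℓ) ↔ y ∈ A₁ ℓ))
    (hrec : ∀ ℓ, Kol ℓ → ∀ d : V₂, (∀ v, v ≠ pl ℓ → v ≠ q₀ → d ∈ Loc₂ v) → d ∉ Loc₂ (pl ℓ) →
      ∀ s : V₂, (∀ v, v ≠ q₀ → s ∈ Loc₂ v) → s ∉ A₂ ℓ → s ∉ A₂₀)
    (hceb : ∀ s : V₂, s ≠ 0 → (∀ v, v ≠ q₀ → s ∈ Loc₂ v) → ∃ ℓ, Kol ℓ ∧ s ∉ A₂ ℓ ∧ y ∉ A₁ ℓ)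
    (hline₂ : ∀ s t : V₂, s ∈ Loc₂ q₀ → t ∈ Loc₂ q₀ → s ∉ A₂₀ → t ∉ A₂₀ → s - t ∈ A₂₀)
    (Sel₂ : AddSubgroup V₂) (hsel₂ : ∀ s, s ∈ Sel₂ ↔ ∀ v, s ∈ Loc₂ v)
    (heven : ∀ s ∈ Sel₂, s ≠ 0 → ∃ t ∈ Sel₂, t ≠ 0 ∧ t ≠ s) :
    Nat.card Sel₂ = 1 := by
  rw [twinSel_eq_bot₂ Loc₂ q₀ A₂₀ Kol pl A₁ A₂ y c₂ hc hcℓ hrec hceb hline₂ Sel₂ hsel₂ heven]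
  exact AddSubgroup.card_bot

/-! ### Discharging the Čebotarev hypotheses from a VISIBLE Čebotarev statement

At instantiation Kolyvagin primes are produced by Čebotarev in `K(E[2])/ℚ` for classes read after the restriction maps
`rK₁ : H¹(ℚ, E[2]) → Hom(G_{K(E[2])}, E[2])`, `rK₂ : H¹(ℚ, E^{(d)}[2]) → Hom(G_{K(E[2])}, E[2])` (both injective:
`H¹(Gal(K(E[2])/ℚ), E[2]) = H¹(S₃ × C₂, 𝔽₂²) = 0` on the slice), and the strict condition at a Kolyvagin prime is detected after
restriction (`u ∈ A ℓ ↔ rK u` vanishes on the decomposition groups above `ℓ`, abstractly `rK u ∈ D ℓ`).  A genuine Čebotarev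
statement serves a pair of classes with DISTINCT non-zero restrictions; the lemmas below add the two degenerate cases. -/

variable {H : Type*} [AddCommGroup H]

/-- **E-side `hceb₂` from a visible pair statement**: if Kolyvagin primes exist for every pair of classes of `V₁` with distinct
non-zero images under an injective `rK₁`, they exist for every `s ∉ {0, y}` paired with `y`. [cite: McCallumLMS1991, Cor. 3.2]
[cite: GrossLMS1991, Prop. 9.1 and §10] -/
theorem hceb₂_of_visible₁ (Loc₁ : Pl → AddSubgroup V₁) (q₀ : Pl) (Kol : ℕ → Prop) (A₁ : ℕ → AddSubgroup V₁) (y : V₁)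
    (rK₁ : V₁ →+ H) (hinj : Function.Injective rK₁) (hy0 : y ≠ 0)
    (hpair : ∀ s : V₁, (∀ v, v ≠ q₀ → s ∈ Loc₁ v) → rK₁ s ≠ 0 → rK₁ y ≠ 0 → rK₁ s ≠ rK₁ y →
      ∃ ℓ, Kol ℓ ∧ s ∉ A₁ ℓ ∧ y ∉ A₁ ℓ) :
    ∀ s : V₁, s ≠ 0 → s ≠ y → (∀ v, v ≠ q₀ → s ∈ Loc₁ v) → ∃ ℓ, Kol ℓ ∧ s ∉ A₁ ℓ ∧ y ∉ A₁ ℓ := by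
  intro s hs0 hsy hs
  refine hpair s hs ?_ ?_ ?_
  · exact fun h => hs0 (hinj (by rw [h, map_zero]))
  · exact fun h => hy0 (hinj (by rw [h, map_zero]))
  · exact fun h => hsy (hinj h)

/-- **Twin-side `hceb` from a visible pair statement**: Kolyvagin primes for the pair `(y ∈ V₁, s ∈ V₂)` when `rK₂ s ≠ rK₁ y`
(genuine Čebotarev, `hpair`), and for the one class with `rK₂ s = rK₁ y` (the twin copy of `y`) from ANY Kolyvagin prime singular
for `y` (`hceb₁`), because the strict conditions are read after restriction (`hA₁`, `hA₂`). [cite: McCallumLMS1991, Cor. 3.2 and p. 299]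
[cite: Kolyvagin1989Izv, §3] -/
theorem hceb₂_of_visible₂ (Loc₂ : Pl → AddSubgroup V₂) (q₀ : Pl) (Kol : ℕ → Prop) (A₁ : ℕ → AddSubgroup V₁)
    (A₂ : ℕ → AddSubgroup V₂) (y : V₁) (rK₁ : V₁ →+ H) (rK₂ : V₂ →+ H) (D : ℕ → AddSubgroup H)
    (hinj₂ : Function.Injective rK₂)
    (hA₁ : ∀ ℓ, Kol ℓ → ∀ u : V₁, u ∈ A₁ ℓ ↔ rK₁ u ∈ D ℓ) (hA₂ : ∀ ℓ, Kol ℓ → ∀ w : V₂, w ∈ A₂ ℓ ↔ rK₂ w ∈ D ℓ)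
    (hceb₁ : ∃ ℓ, Kol ℓ ∧ y ∉ A₁ ℓ)
    (hpair : ∀ s : V₂, (∀ v, v ≠ q₀ → s ∈ Loc₂ v) → rK₂ s ≠ 0 → rK₂ s ≠ rK₁ y →
      ∃ ℓ, Kol ℓ ∧ s ∉ A₂ ℓ ∧ y ∉ A₁ ℓ) :
    ∀ s : V₂, s ≠ 0 → (∀ v, v ≠ q₀ → s ∈ Loc₂ v) → ∃ ℓ, Kol ℓ ∧ s ∉ A₂ ℓ ∧ y ∉ A₁ ℓ := by
  intro s hs0 hs
  by_cases hcopy : rK₂ s = rK₁ y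
  · obtain ⟨ℓ, hℓ, hyA⟩ := hceb₁
    refine ⟨ℓ, hℓ, fun hsA => hyA ?_, hyA⟩
    exact (hA₁ ℓ hℓ y).mpr (hcopy ▸ (hA₂ ℓ hℓ s).mp hsA)
  · exact hpair s hs (fun h => hs0 (hinj₂ (by rw [h, map_zero]))) hcopy

end FirstDescentPairAtTwo

end Summit.BirchSwinnertonDyer.BirchSwinnertonDyer.Theorems.RankOneAtTwoOneDoor
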